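import Summits.NavierStokesRegularity.NavierStokesRegularity.Theorems.ScenarioCensusRowF1TwoTimeTopSignals
import Summits.NavierStokesRegularity.NavierStokesRegularity.Theorems.ScenarioCensusRowF1SymmetricTopTransfer
import HarnessLib

/-!
# LINE 34 «two-time-top» port, part 3/4: §4 TRANSFERS — the four physical two-time read-outs reach the zoom limit at the Type-I scale

Re-homed for the scenario census (typer seat ns-census-typer-1 g9; the cells F1dj / F1gl / F1ge / F1de and the floors are MEMBERS OF RECORD «DECIDED IN KERNEL IN FILES» of row
F1 since census v1.100 (item 70: critic PASS; ref ns-census-ref g13 PRE-CHECK ✓ §18.6; lead-presearch label); this port makes them TREE-decided): VERBATIM PORT of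
ns-idea-3 LINE 34 «two-time-top», `pub/ideators/ns-idea-3/lines/two-time-top/line-two-time-top.lean` sha16 26867eeb269186b0 (1077 l., lean check rc 0, 0 sorry), split
for the 400-line rule into `ScenarioCensusRowF1TwoTimeTop` (§1–§2) → `…TwoTimeTopSignals` (§3) → `…TwoTimeTopTransfer` (§4) → `…TwoTimeTopRows` (§5–§6 + census KEYS).
Lean text VERBATIM in namespace `…Theorems.ScenarioCensus.TwoTimeTop` (the line's `…Cruxes.ScenarioCensusRowF1.TwoTimeTopLine` re-homed); port edits: §2's zoom package /
`tendsto_physicalTime` / `eventually_top` (LINES 15/33 VERBATIM) are taken BY NAME from the landed columnar-top / symmetric-top ports; `@[conjecture]` on the residual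
`PersistenceCollapse` (≡ `ScenarioCensus.Row_F1`, OPEN); docstrings complete.  Statements untouched.

No census VALUE is moved here (row F1 stays OPEN-WITH-LINE; the members become TREE-decided by name); NS regularity is NOT proved; `Row_F1` is untouched (zero
movement, `persistenceCollapse_iff_rowF1`); no summit statement is proved by this file. Lemmas that restate already-landed tree declarations are taken BY NAME (gate lint `dedup.landed`): `exists_singularZoom_package` = `ColumnarTop.exists_singularZoom_package`, `tendsto_physicalTime` = `ColumnarTop.tendsto_physicalTime`, `eventually_top` = `SymmetricTop.eventually_top`.
-/

-- the summit and its single problem share the name `NavierStokesRegularity` (D-0017 nested layout)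
set_option linter.dupNamespace false

noncomputable section

open MeasureTheory Set Function Filter TopologicalSpace Metric
open scoped Topology NNReal ENNReal

namespace Summit.NavierStokesRegularity.NavierStokesRegularity.Theorems.ScenarioCensus.TwoTimeTop

open Literature.Analysis Literature.Analysis.FluidPDE
open Summit.NavierStokesRegularity.NavierStokesRegularity.Theorems
open Summit.NavierStokesRegularity.NavierStokesRegularity.Theses

/-! ## §4 TRANSFERS: the four physical two-time read-outs reach the zoom limit at the Type-I scale (values only)

The zoom at a singular point has scales `c_j ↓ 0`; rescaled time `t < 0` corresponds to the physical time
`τ_j = T + c_j² β t`, and the LAGGED physical time `τ_j − θ(T − τ_j)` is EXACTLY the physical time of the rescaled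
instant `(1+θ)t` at the same scale: `lagTime T θ τ_j = T + c_j² β (1+θ) t`.  So a two-time read-out at lag `θ`
becomes, in the limit, a relation between `W(t, y)` and `W((1+θ)t, y)` — pointwise convergence of VALUES suffices
(no gradients, no time derivatives: this is what makes time-lag read-outs transferable where `∂ₜu` read-outs are
not). Top membership of the zoom points at the relevant level is the bookkeeping lemma `SymmetricTop.eventually_top`. -/

/-- The lagged physical time of the zoom is the physical time of the rescaled instant `(1+θ)t`. -/
theorem lagTime_zoom (T θ β t cj : ℝ) : lagTime T θ (T + cj ^ 2 * β * t) = T + cj ^ 2 * β * ((1 + θ) * t) := by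
  unfold lagTime; ring

/-- **Top bookkeeping, early anchor**: if `W((1+θ)t, y) ≠ 0` the zoom points are on the top of a fixed positive
level at the LAGGED physical times, eventually. -/
theorem eventually_top_lag {T ν θ : ℝ} {u : ℝ → E3 → E3} {x₀ : E3} {α β R : ℝ} {c : ℕ → ℝ} {W : ℝ → E3 → E3}
    (hν : 0 < ν) (hα : 0 < α) (hβ : 0 < β) (hcpos : ∀ j, 0 < c j)
    (hpt : ∀ t < 0, ∀ y : E3,
      Tendsto (fun j => (c j * α) • u (T + c j ^ 2 * β * t) (x₀ + (c j * R) • y)) atTop (𝓝 (W t y)))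
    (hθ : 0 < θ) {t : ℝ} (ht : t < 0) {y : E3} (hne : W ((1 + θ) * t) y ≠ 0) :
    ∀ᶠ j in atTop, x₀ + (c j * R) • y ∈
      topSet ν T u (Real.sqrt (β * (-((1 + θ) * t))) * ‖W ((1 + θ) * t) y‖ / (4 * α * Real.sqrt ν))
        (lagTime T θ (T + c j ^ 2 * β * t)) := by
  have hκt : (1 + θ) * t < 0 := mul_neg_of_pos_of_neg (by linarith) ht
  filter_upwards [SymmetricTop.eventually_top hν hα hβ hcpos hpt hκt hne] with j hj
  rw [mem_topSet, lagTime_zoom]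
  exact hj

/-- The zoom values at the lagged physical times converge to `W((1+θ)t, y)`. -/
theorem tendsto_zoom_lag {T θ : ℝ} {u : ℝ → E3 → E3} {x₀ : E3} {α β R : ℝ} {c : ℕ → ℝ} {W : ℝ → E3 → E3}
    (hpt : ∀ t < 0, ∀ y : E3,
      Tendsto (fun j => (c j * α) • u (T + c j ^ 2 * β * t) (x₀ + (c j * R) • y)) atTop (𝓝 (W t y)))
    (hθ : 0 < θ) {t : ℝ} (ht : t < 0) (y : E3) :
    Tendsto (fun j => (c j * α) • u (lagTime T θ (T + c j ^ 2 * β * t)) (x₀ + (c j * R) • y)) atTop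
      (𝓝 (W ((1 + θ) * t) y)) := by
  have hκt : (1 + θ) * t < 0 := mul_neg_of_pos_of_neg (by linarith) ht
  have e : (fun j => (c j * α) • u (lagTime T θ (T + c j ^ 2 * β * t)) (x₀ + (c j * R) • y)) =
      fun j => (c j * α) • u (T + c j ^ 2 * β * ((1 + θ) * t)) (x₀ + (c j * R) • y) :=
    funext fun j => by rw [lagTime_zoom]
  rw [e]
  exact hpt _ hκt y

/-- **Transfer (DJ).** Disjoint tops at lag `θ` ⇒ the limit has time-disjoint supports at ratio `1+θ`. -/
theorem disjointTops_transfer {T ν θ : ℝ} {u : ℝ → E3 → E3} {x₀ : E3} {α β R : ℝ} {c : ℕ → ℝ}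
    {W : ℝ → E3 → E3}
    (hν : 0 < ν) (hα : 0 < α) (hβ : 0 < β) (hcpos : ∀ j, 0 < c j) (hclim : Tendsto c atTop (𝓝 0))
    (hpt : ∀ t < 0, ∀ y : E3,
      Tendsto (fun j => (c j * α) • u (T + c j ^ 2 * β * t) (x₀ + (c j * R) • y)) atTop (𝓝 (W t y)))
    (hθ : 0 < θ) (hH : HasDisjointTops ν T θ u) :
    ∀ t < 0, ∀ y : E3, W ((1 + θ) * t) y = 0 ∨ W t y = 0 := by
  intro t ht y
  by_contra hnot
  have hne1 : W ((1 + θ) * t) y ≠ 0 := fun h => hnot (Or.inl h)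
  have hne2 : W t y ≠ 0 := fun h => hnot (Or.inr h)
  have hsν : 0 ≤ Real.sqrt ν := Real.sqrt_nonneg _
  set Λ₁ : ℝ := Real.sqrt (β * (-((1 + θ) * t))) * ‖W ((1 + θ) * t) y‖ / (4 * α * Real.sqrt ν) with hΛ₁
  set Λ₂ : ℝ := Real.sqrt (β * (-t)) * ‖W t y‖ / (4 * α * Real.sqrt ν) with hΛ₂
  have hκt : 0 < -((1 + θ) * t) := by nlinarith
  have hΛ₁pos : 0 < Λ₁ := by
    have : 0 < ‖W ((1 + θ) * t) y‖ := norm_pos_iff.2 hne1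
    have : 0 < Real.sqrt ν := Real.sqrt_pos.2 hν
    have : 0 < Real.sqrt (β * (-((1 + θ) * t))) := Real.sqrt_pos.2 (mul_pos hβ hκt)
    positivity
  have hΛ₂pos : 0 < Λ₂ := by
    have : 0 < ‖W t y‖ := norm_pos_iff.2 hne2
    have : 0 < Real.sqrt ν := Real.sqrt_pos.2 hν
    have : 0 < Real.sqrt (β * (-t)) := Real.sqrt_pos.2 (mul_pos hβ (neg_pos.2 ht))
    positivity
  set Λ : ℝ := min Λ₁ Λ₂ with hΛ
  have hΛpos : 0 < Λ := lt_min hΛ₁pos hΛ₂pos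
  have htop1 := eventually_top_lag hν hα hβ hcpos hpt hθ ht hne1
  have htop2 : ∀ᶠ j in atTop, x₀ + (c j * R) • y ∈ topSet ν T u Λ₂ (T + c j ^ 2 * β * t) :=
    SymmetricTop.eventually_top hν hα hβ hcpos hpt ht hne2
  have hev := (ColumnarTop.tendsto_physicalTime (T := T) hβ ht hcpos hclim).eventually (hH Λ hΛpos)
  obtain ⟨j, hj1, hj2, hj3⟩ := (htop1.and (htop2.and hev)).exists
  exact Set.disjoint_left.1 hj3 (mem_topSet_of_le hsν (min_le_left _ _) hj1)
    (mem_topSet_of_le hsν (min_le_right _ _) hj2)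

/-- **Transfer (GL).** Late-anchored super-self-similar growth ⇒ late-anchored contraction of the limit signal. -/
theorem lateGrowth_transfer {T ν θ q : ℝ} {u : ℝ → E3 → E3} {x₀ : E3} {α β R : ℝ} {c : ℕ → ℝ}
    {W : ℝ → E3 → E3}
    (hν : 0 < ν) (hα : 0 < α) (hβ : 0 < β) (hcpos : ∀ j, 0 < c j) (hclim : Tendsto c atTop (𝓝 0))
    (hpt : ∀ t < 0, ∀ y : E3,
      Tendsto (fun j => (c j * α) • u (T + c j ^ 2 * β * t) (x₀ + (c j * R) • y)) atTop (𝓝 (W t y)))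
    (hθ : 0 < θ) (hH : HasLateGrowth ν T θ q u) :
    ∀ t < 0, ∀ y : E3, W t y ≠ 0 → Real.sqrt (1 + θ) * ‖W ((1 + θ) * t) y‖ ≤ q * ‖W t y‖ := by
  intro t ht y hne
  set Λ : ℝ := Real.sqrt (β * (-t)) * ‖W t y‖ / (4 * α * Real.sqrt ν) with hΛ
  have hΛpos : 0 < Λ := by
    have : 0 < ‖W t y‖ := norm_pos_iff.2 hne
    have : 0 < Real.sqrt ν := Real.sqrt_pos.2 hν
    have : 0 < Real.sqrt (β * (-t)) := Real.sqrt_pos.2 (mul_pos hβ (neg_pos.2 ht))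
    positivity
  have htop : ∀ᶠ j in atTop, x₀ + (c j * R) • y ∈ topSet ν T u Λ (T + c j ^ 2 * β * t) :=
    SymmetricTop.eventually_top hν hα hβ hcpos hpt ht hne
  have hev := (ColumnarTop.tendsto_physicalTime (T := T) hβ ht hcpos hclim).eventually (hH Λ hΛpos)
  have hineq : ∀ᶠ j in atTop,
      Real.sqrt (1 + θ) * ‖(c j * α) • u (lagTime T θ (T + c j ^ 2 * β * t)) (x₀ + (c j * R) • y)‖ ≤
        q * ‖(c j * α) • u (T + c j ^ 2 * β * t) (x₀ + (c j * R) • y)‖ := by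
    filter_upwards [htop, hev] with j hj1 hj2
    have h := hj2 _ hj1
    have hcα : 0 < c j * α := mul_pos (hcpos j) hα
    rw [norm_smul, norm_smul, Real.norm_eq_abs, abs_of_pos hcα]
    calc Real.sqrt (1 + θ) * (c j * α * ‖u (lagTime T θ (T + c j ^ 2 * β * t)) (x₀ + (c j * R) • y)‖)
        = c j * α * (Real.sqrt (1 + θ) * ‖u (lagTime T θ (T + c j ^ 2 * β * t)) (x₀ + (c j * R) • y)‖) := by
          ring
      _ ≤ c j * α * (q * ‖u (T + c j ^ 2 * β * t) (x₀ + (c j * R) • y)‖) :=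
          mul_le_mul_of_nonneg_left h hcα.le
      _ = q * (c j * α * ‖u (T + c j ^ 2 * β * t) (x₀ + (c j * R) • y)‖) := by ring
  exact le_of_tendsto_of_tendsto ((tendsto_zoom_lag hpt hθ ht y).norm.const_mul _)
    ((hpt t ht y).norm.const_mul q) hineq

/-- **Transfer (GE).** Early-anchored super-self-similar growth ⇒ early-anchored contraction of the limit signal. -/
theorem earlyGrowth_transfer {T ν θ q : ℝ} {u : ℝ → E3 → E3} {x₀ : E3} {α β R : ℝ} {c : ℕ → ℝ}
    {W : ℝ → E3 → E3}
    (hν : 0 < ν) (hα : 0 < α) (hβ : 0 < β) (hcpos : ∀ j, 0 < c j) (hclim : Tendsto c atTop (𝓝 0))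
    (hpt : ∀ t < 0, ∀ y : E3,
      Tendsto (fun j => (c j * α) • u (T + c j ^ 2 * β * t) (x₀ + (c j * R) • y)) atTop (𝓝 (W t y)))
    (hθ : 0 < θ) (hH : HasEarlyGrowth ν T θ q u) :
    ∀ t < 0, ∀ y : E3, W ((1 + θ) * t) y ≠ 0 →
      Real.sqrt (1 + θ) * ‖W ((1 + θ) * t) y‖ ≤ q * ‖W t y‖ := by
  intro t ht y hne
  set Λ : ℝ := Real.sqrt (β * (-((1 + θ) * t))) * ‖W ((1 + θ) * t) y‖ / (4 * α * Real.sqrt ν) with hΛ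
  have hκt : 0 < -((1 + θ) * t) := by nlinarith
  have hΛpos : 0 < Λ := by
    have : 0 < ‖W ((1 + θ) * t) y‖ := norm_pos_iff.2 hne
    have : 0 < Real.sqrt ν := Real.sqrt_pos.2 hν
    have : 0 < Real.sqrt (β * (-((1 + θ) * t))) := Real.sqrt_pos.2 (mul_pos hβ hκt)
    positivity
  have htop := eventually_top_lag hν hα hβ hcpos hpt hθ ht hne
  have hev := (ColumnarTop.tendsto_physicalTime (T := T) hβ ht hcpos hclim).eventually (hH Λ hΛpos)
  have hineq : ∀ᶠ j in atTop,
      Real.sqrt (1 + θ) * ‖(c j * α) • u (lagTime T θ (T + c j ^ 2 * β * t)) (x₀ + (c j * R) • y)‖ ≤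
        q * ‖(c j * α) • u (T + c j ^ 2 * β * t) (x₀ + (c j * R) • y)‖ := by
    filter_upwards [htop, hev] with j hj1 hj2
    have h := hj2 _ hj1
    have hcα : 0 < c j * α := mul_pos (hcpos j) hα
    rw [norm_smul, norm_smul, Real.norm_eq_abs, abs_of_pos hcα]
    calc Real.sqrt (1 + θ) * (c j * α * ‖u (lagTime T θ (T + c j ^ 2 * β * t)) (x₀ + (c j * R) • y)‖)
        = c j * α * (Real.sqrt (1 + θ) * ‖u (lagTime T θ (T + c j ^ 2 * β * t)) (x₀ + (c j * R) • y)‖) := by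
          ring
      _ ≤ c j * α * (q * ‖u (T + c j ^ 2 * β * t) (x₀ + (c j * R) • y)‖) :=
          mul_le_mul_of_nonneg_left h hcα.le
      _ = q * (c j * α * ‖u (T + c j ^ 2 * β * t) (x₀ + (c j * R) • y)‖) := by ring
  exact le_of_tendsto_of_tendsto ((tendsto_zoom_lag hpt hθ ht y).norm.const_mul _)
    ((hpt t ht y).norm.const_mul q) hineq

/-- **Transfer (DE).** Early-anchored fast dimming ⇒ early-anchored backward escalation of the limit signal. -/
theorem earlyDecay_transfer {T ν θ q : ℝ} {u : ℝ → E3 → E3} {x₀ : E3} {α β R : ℝ} {c : ℕ → ℝ}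
    {W : ℝ → E3 → E3}
    (hν : 0 < ν) (hα : 0 < α) (hβ : 0 < β) (hcpos : ∀ j, 0 < c j) (hclim : Tendsto c atTop (𝓝 0))
    (hpt : ∀ t < 0, ∀ y : E3,
      Tendsto (fun j => (c j * α) • u (T + c j ^ 2 * β * t) (x₀ + (c j * R) • y)) atTop (𝓝 (W t y)))
    (hθ : 0 < θ) (hH : HasEarlyDecay ν T θ q u) :
    ∀ t < 0, ∀ y : E3, W ((1 + θ) * t) y ≠ 0 →
      ‖W t y‖ ≤ q * Real.sqrt (1 + θ) * ‖W ((1 + θ) * t) y‖ := by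
  intro t ht y hne
  set Λ : ℝ := Real.sqrt (β * (-((1 + θ) * t))) * ‖W ((1 + θ) * t) y‖ / (4 * α * Real.sqrt ν) with hΛ
  have hκt : 0 < -((1 + θ) * t) := by nlinarith
  have hΛpos : 0 < Λ := by
    have : 0 < ‖W ((1 + θ) * t) y‖ := norm_pos_iff.2 hne
    have : 0 < Real.sqrt ν := Real.sqrt_pos.2 hν
    have : 0 < Real.sqrt (β * (-((1 + θ) * t))) := Real.sqrt_pos.2 (mul_pos hβ hκt)
    positivity
  have htop := eventually_top_lag hν hα hβ hcpos hpt hθ ht hne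
  have hev := (ColumnarTop.tendsto_physicalTime (T := T) hβ ht hcpos hclim).eventually (hH Λ hΛpos)
  have hineq : ∀ᶠ j in atTop,
      ‖(c j * α) • u (T + c j ^ 2 * β * t) (x₀ + (c j * R) • y)‖ ≤
        q * Real.sqrt (1 + θ) *
          ‖(c j * α) • u (lagTime T θ (T + c j ^ 2 * β * t)) (x₀ + (c j * R) • y)‖ := by
    filter_upwards [htop, hev] with j hj1 hj2
    have h := hj2 _ hj1
    have hcα : 0 < c j * α := mul_pos (hcpos j) hα
    rw [norm_smul, norm_smul, Real.norm_eq_abs, abs_of_pos hcα]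
    calc c j * α * ‖u (T + c j ^ 2 * β * t) (x₀ + (c j * R) • y)‖
        ≤ c j * α * (q * Real.sqrt (1 + θ) *
            ‖u (lagTime T θ (T + c j ^ 2 * β * t)) (x₀ + (c j * R) • y)‖) :=
          mul_le_mul_of_nonneg_left h hcα.le
      _ = q * Real.sqrt (1 + θ) *
            (c j * α * ‖u (lagTime T θ (T + c j ^ 2 * β * t)) (x₀ + (c j * R) • y)‖) := by ring
  exact le_of_tendsto_of_tendsto (hpt t ht y).norm
    ((tendsto_zoom_lag hpt hθ ht y).norm.const_mul _) hineq

end Summit.NavierStokesRegularity.NavierStokesRegularity.Theorems.ScenarioCensus.TwoTimeTop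

end
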